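import Summits.BirchSwinnertonDyer.Rank1Residual.X11b.IntSeriesValueRigidity
import HarnessLib

/-!
# Class X11b, every prime `p`: ♭-V1RIG at the BDP frames — two ♭-frames
# `R1.IsBDPLFunctionInt p ι 𝔭 κ γ f Ω_K Ω_p Q`, `… Ω_K' Ω_p' Q'` of the SAME `(ι, 𝔭, κ, γ, f)` with ANY
# non-zero periods have `[T⁰]Q' = [T⁰]Q`; at anticyclotomic data (odd `p`) WITHOUT supply hypotheses
# (cell `b2b-bsdres`, sub-cell `multr1-p2`, gen 25; sequel of `IntSeriesValueRigidity.lean`)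

HONEST FRAMING (cell `b2b-bsdres`, run/shared/lean/b2b/bsd-rank1-residual/, verbatim in every
file): the goal of the cell is to DELETE the COMBINATION-SHAPED residual classes of the
Birch–Swinnerton-Dyer formula for ALL analytic-rank `≤ 1` elliptic curves over `ℚ` — "full BSD
formula for every rank `≤ 1` curve in class `C`" assembled STRICTLY from published theorems — so
that the rank-`≤ 1` remainder becomes exactly the CONSTRUCTION-SHAPED classes, which are TYPED
(missing-input `Prop`s), NOT attempted. This is not "finishing BSD". Sub-cell `multr1-p2` is a
RESEARCH ROUTE on class X11b (`ClassX11b W p := r_an = 1 ∧ p ≠ 2 ∧ mult(p) ∧ irr(p)`); no claim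
beyond the stated class and loci; X11b's label does not change; NOTHING is booked by this file.

THEOREMS ONLY (no definition, no named fact, no `sorry`). CREDIT: `IntSeries` twin of x11b3-p3's
`constantCoeff_eq_of_isBDPLFunction_of_supply` (S27 'V1RIG', `X11b/BDPValueRigidity.lean`, p263893),
proof VERBATIM with `R₀ ↦ 𝓞_{ℂ_p}`; their `bdpInterpolationValue_rescale` / `frameValue_rescale` are
IMPORTED. The supply-free form uses gen 25's `exists_interpolationSupply_pow`.

## What this file proves

* `intSeries_hasValueAt_frame_rescale`: at an interpolation point the second frame takes the first
  frame's value times `β^n`, `β = ι⁻¹((Ω_K/Ω_K')⁴)·(Ω_p'/Ω_p)⁴`.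
* **`constantCoeff_eq_of_isBDPLFunctionInt_of_supply`** (any `p`; x11b3's supply binders VERBATIM).
* **`constantCoeff_eq_of_isBDPLFunctionInt_of_isAnticyclotomic`** (odd `p`, `K` imaginary quadratic,
  `κ` anticyclotomic with topological generator `γ`; NO supply hypothesis): the value at `𝟙` of a
  ♭-frame does not see the periods. CONSEQUENCE for route p2: the value conjunct 3.2♭ of H∃♭ can be
  read off ANY ♭-frame at the datum (sequel `X11b/BDPRouteOpenInputSplit.lean`).

## References

* [Castella2018] F. Castella, Math. Ann. 370 (2018), Thms. 3.1–3.2 (arXiv:1704.06608 pp. 8–9).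
* [CastellaHsieh2018] §3.3, Def. 3.5, Prop. 3.6.
-/

noncomputable section

open scoped Classical Topology NumberField
open Filter NumberField IsDedekindDomain Field PowerSeries
  Literature.NumberTheory.EllipticCurves Literature.NumberTheory.GaloisRepresentations

namespace Summit.BirchSwinnertonDyer.Rank1Residual.X11b

variable {p : ℕ} [Fact p.Prime]

/-! ### §3 ♭-V1RIG: the value at `𝟙` of a ♭-frame does not see the periods -/

section BDP

variable {K : Type} [Field K] [NumberField K] {N : ℕ}

/-- **At an interpolation point the second ♭-frame takes the first frame's value times `β^n`**
(`β = ι⁻¹((Ω_K/Ω_K')⁴)·(Ω_p'/Ω_p)⁴`; x11b3-p3's `hasValueAt_frame_rescale` for `IntSeries`).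
[cite: Castella2018, Thm. 3.1 (arXiv:1704.06608 p. 9)] -/
theorem intSeries_hasValueAt_frame_rescale {ι : PadicAlgCl p ≃+* ℂ} {𝔭 : HeightOneSpectrum (𝓞 K)}
    {κ : ZpExtension K p} {γ : Field.absoluteGaloisGroup K}
    {f : CuspForm (CongruenceSubgroup.Gamma0 N) 2} {ΩK ΩK' : ℂ} {Ωp Ωp' : ℂ_[p]}
    {Q' : PowerSeries 𝓞_ℂ_[p]} (hΩK : ΩK ≠ 0) (hΩK' : ΩK' ≠ 0) (hΩp : Ωp ≠ 0)
    (hQ' : R1.IsBDPLFunctionInt p ι 𝔭 κ γ f ΩK' Ωp' Q')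
    {φ : HeckeCharacter K} {n : ℕ} {r : FramedGaloisRep K (PadicAlgCl p) 1} (hn : 0 < n)
    (hunr : ∀ v : HeightOneSpectrum (𝓞 K), φ.IsUnramifiedAt v)
    (hinf : φ.HasInfinityType (fun _ ↦ (n : ℤ)) (fun _ ↦ -(n : ℤ)))
    (hr : IsPAdicAvatarOf ι φ r) (hκ : FactorsThroughZp κ r) :
    IntSeries.HasValueAt Q' (avatarValueAt r γ - 1)
      (((ι.symm (bdpInterpolationValue p f 𝔭 φ n ΩK) : PadicAlgCl p) : ℂ_[p]) * Ωp ^ (4 * n) *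
        (((ι.symm ((ΩK / ΩK') ^ 4) : PadicAlgCl p) : ℂ_[p]) * (Ωp' / Ωp) ^ 4) ^ n) := by
  rw [← frameValue_rescale ι f 𝔭 φ n hΩK hΩK' Ωp' hΩp]
  exact hQ' φ n hn hunr hinf r hr hκ

/-- **♭-V1RIG with a supply** (any prime `p`; x11b3-p3's `constantCoeff_eq_of_isBDPLFunction_of_supply`
for `R1.IsBDPLFunctionInt` / `𝓞_{ℂ_p}⟦T⟧`, binders VERBATIM): two ♭-frames of the SAME
`(ι, 𝔭, κ, γ, f)` with periods `Ω_K, Ω_K' ≠ 0`, `Ω_p, Ω_p' ≠ 0` and a character supply at `(ι, κ, γ)`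
have `[T⁰]Q' = [T⁰]Q`. [cite: Castella2018, Thm. 3.1–3.2 (arXiv:1704.06608 pp. 8–9)]
[cite: CastellaHsieh2018, §3.3, Def. 3.5 and Prop. 3.6] -/
theorem constantCoeff_eq_of_isBDPLFunctionInt_of_supply (K : Type) [Field K] [NumberField K] (N : ℕ)
    (ι : PadicAlgCl p ≃+* ℂ) (𝔭 : HeightOneSpectrum (𝓞 K)) (κ : ZpExtension K p)
    (γ : Field.absoluteGaloisGroup K) (f : CuspForm (CongruenceSubgroup.Gamma0 N) 2) (ΩK ΩK' : ℂ)
    (Ωp Ωp' : ℂ_[p]) (Q Q' : PowerSeries 𝓞_ℂ_[p]) (m : ℕ) (x₀ : ℂ_[p]) (φ φ' : ℕ → HeckeCharacter K)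
    (r r' : ℕ → FramedGaloisRep K (PadicAlgCl p) 1)
    (hm : 0 < m) (hx : Tendsto (fun k ↦ x₀ ^ p ^ k) atTop (𝓝 1))
    (hunr : ∀ k (v : HeightOneSpectrum (𝓞 K)), (φ k).IsUnramifiedAt v)
    (hinf : ∀ k, (φ k).HasInfinityType (fun _ ↦ ((m * p ^ k : ℕ) : ℤ))
      (fun _ ↦ -((m * p ^ k : ℕ) : ℤ)))
    (hr : ∀ k, IsPAdicAvatarOf ι (φ k) (r k)) (hrκ : ∀ k, FactorsThroughZp κ (r k))
    (hval : ∀ k, avatarValueAt (r k) γ = x₀ ^ p ^ k)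
    (hunr' : ∀ k (v : HeightOneSpectrum (𝓞 K)), (φ' k).IsUnramifiedAt v)
    (hinf' : ∀ k, (φ' k).HasInfinityType (fun _ ↦ ((2 * m * p ^ k : ℕ) : ℤ))
      (fun _ ↦ -((2 * m * p ^ k : ℕ) : ℤ)))
    (hr' : ∀ k, IsPAdicAvatarOf ι (φ' k) (r' k)) (hrκ' : ∀ k, FactorsThroughZp κ (r' k))
    (hval' : ∀ k, avatarValueAt (r' k) γ = x₀ ^ (2 * p ^ k))
    (hΩK : ΩK ≠ 0) (hΩK' : ΩK' ≠ 0) (hΩp : Ωp ≠ 0) (hΩp' : Ωp' ≠ 0)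
    (hQ : R1.IsBDPLFunctionInt p ι 𝔭 κ γ f ΩK Ωp Q)
    (hQ' : R1.IsBDPLFunctionInt p ι 𝔭 κ γ f ΩK' Ωp' Q') :
    constantCoeff Q' = constantCoeff Q := by
  have hp : p.Prime := Fact.out
  -- the points `T_k = x₀^(p^k) − 1 → 0`
  set T : ℕ → ℂ_[p] := fun k ↦ x₀ ^ p ^ k - 1 with hT
  have hT0 : Tendsto T atTop (𝓝 0) := by
    have h := hx.sub_const 1
    rwa [sub_self] at h
  -- the period ratio `β` and the factors `a_k = β^(m p^k) ≠ 0`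
  set β : ℂ_[p] := ((ι.symm ((ΩK / ΩK') ^ 4) : PadicAlgCl p) : ℂ_[p]) * (Ωp' / Ωp) ^ 4 with hβ
  have hβ0 : β ≠ 0 := by
    refine mul_ne_zero ?_ (pow_ne_zero _ (div_ne_zero hΩp' hΩp))
    rw [PadicComplex.coe_eq]
    exact (map_ne_zero_iff _ (algebraMap (PadicAlgCl p) ℂ_[p]).injective).mpr
      ((map_ne_zero_iff _ ι.symm.injective).mpr (pow_ne_zero _ (div_ne_zero hΩK hΩK')))
  set a : ℕ → ℂ_[p] := fun k ↦ β ^ (m * p ^ k) with ha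
  have ha0 : ∀ k, a k ≠ 0 := fun k ↦ pow_ne_zero _ hβ0
  have hn : ∀ k, 0 < m * p ^ k := fun k ↦ Nat.mul_pos hm (pow_pos hp.pos k)
  have hn' : ∀ k, 0 < 2 * m * p ^ k := fun k ↦ Nat.mul_pos (Nat.mul_pos two_pos hm) (pow_pos hp.pos k)
  have hT' : ∀ k, x₀ ^ (2 * p ^ k) - 1 = T k * (T k + 2) := by
    intro k
    simp only [hT]
    ring
  -- values of the first frame
  set v : ℕ → ℂ_[p] := fun k ↦
    ((ι.symm (bdpInterpolationValue p f 𝔭 (φ k) (m * p ^ k) ΩK) : PadicAlgCl p) : ℂ_[p]) *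
      Ωp ^ (4 * (m * p ^ k)) with hv
  set w : ℕ → ℂ_[p] := fun k ↦
    ((ι.symm (bdpInterpolationValue p f 𝔭 (φ' k) (2 * m * p ^ k) ΩK) : PadicAlgCl p) : ℂ_[p]) *
      Ωp ^ (4 * (2 * m * p ^ k)) with hw
  have hQv : ∀ k, IntSeries.HasValueAt Q (T k) (v k) := by
    intro k
    have h := hQ (φ k) (m * p ^ k) (hn k) (hunr k) (hinf k) (r k) (hr k) (hrκ k)
    rwa [hval k] at h
  have hQw : ∀ k, IntSeries.HasValueAt Q (T k * (T k + 2)) (w k) := by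
    intro k
    have h := hQ (φ' k) (2 * m * p ^ k) (hn' k) (hunr' k) (hinf' k) (r' k) (hr' k) (hrκ' k)
    rwa [hval' k, hT' k] at h
  -- values of the second frame, tied by `a_k` and `a_k²`
  have hQ'v : ∀ k, IntSeries.HasValueAt Q' (T k) (a k * v k) := by
    intro k
    have h := intSeries_hasValueAt_frame_rescale hΩK hΩK' hΩp hQ' (hn k) (hunr k) (hinf k) (hr k)
      (hrκ k)
    have hvals : ((ι.symm (bdpInterpolationValue p f 𝔭 (φ k) (m * p ^ k) ΩK) : PadicAlgCl p) :
        ℂ_[p]) * Ωp ^ (4 * (m * p ^ k)) *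
        (((ι.symm ((ΩK / ΩK') ^ 4) : PadicAlgCl p) : ℂ_[p]) * (Ωp' / Ωp) ^ 4) ^ (m * p ^ k) =
        a k * v k := by
      simp only [ha, hv, hβ]
      ring
    rw [hval k, hvals] at h
    exact h
  have hQ'w : ∀ k, IntSeries.HasValueAt Q' (T k * (T k + 2)) (a k ^ 2 * w k) := by
    intro k
    have h := intSeries_hasValueAt_frame_rescale hΩK hΩK' hΩp hQ' (hn' k) (hunr' k) (hinf' k)
      (hr' k) (hrκ' k)
    have hvals : ((ι.symm (bdpInterpolationValue p f 𝔭 (φ' k) (2 * m * p ^ k) ΩK) :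
        PadicAlgCl p) : ℂ_[p]) * Ωp ^ (4 * (2 * m * p ^ k)) *
        (((ι.symm ((ΩK / ΩK') ^ 4) : PadicAlgCl p) : ℂ_[p]) * (Ωp' / Ωp) ^ 4) ^ (2 * m * p ^ k) =
        a k ^ 2 * w k := by
      simp only [ha, hw, hβ]
      ring
    rw [hval' k, hT' k, hvals] at h
    exact h
  exact intSeries_constantCoeff_eq_of_values_mul_sq hT0 ha0 hQv hQ'v hQw hQ'w

/-- **♭-V1RIG WITHOUT SUPPLY HYPOTHESES — the value at `𝟙` of a ♭-frame does not see the periods.**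
For odd `p`, `K` imaginary quadratic, `κ` anticyclotomic with topological generator `γ`: two
`Q, Q' ∈ 𝓞_{ℂ_p}⟦T⟧` with `R1.IsBDPLFunctionInt p ι 𝔭 κ γ f Ω_K Ω_p Q`,
`R1.IsBDPLFunctionInt p ι 𝔭 κ γ f Ω_K' Ω_p' Q'` (SAME `(ι, 𝔭, κ, γ, f)`, ANY periods `Ω_K, Ω_K' ≠ 0`,
`Ω_p, Ω_p' ≠ 0`) have `[T⁰]Q' = [T⁰]Q`. The supply is gen 25's `exists_interpolationSupply_pow`.
CONSEQUENCE for route p2: the value conjunct 3.2♭ of H∃♭ can be read off ANY ♭-frame at the datum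
(sequel `X11b/BDPRouteOpenInputSplit.lean`). [cite: Castella2018, Thm. 3.1–3.2 (arXiv:1704.06608 pp. 8–9)]
[cite: CastellaHsieh2018, §3.3, Def. 3.5 and Prop. 3.6] -/
theorem constantCoeff_eq_of_isBDPLFunctionInt_of_isAnticyclotomic (hp2 : p ≠ 2)
    {ι : PadicAlgCl p ≃+* ℂ} {𝔭 : HeightOneSpectrum (𝓞 K)} {κ : ZpExtension K p}
    {γ : Field.absoluteGaloisGroup K} {f : CuspForm (CongruenceSubgroup.Gamma0 N) 2}
    {ΩK ΩK' : ℂ} {Ωp Ωp' : ℂ_[p]} {Q Q' : PowerSeries 𝓞_ℂ_[p]}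
    (hK : IsImaginaryQuadratic K) (hκ : κ.IsAnticyclotomic) (hγ : κ.IsTopGenerator γ)
    (hΩK : ΩK ≠ 0) (hΩK' : ΩK' ≠ 0) (hΩp : Ωp ≠ 0) (hΩp' : Ωp' ≠ 0)
    (hQ : R1.IsBDPLFunctionInt p ι 𝔭 κ γ f ΩK Ωp Q)
    (hQ' : R1.IsBDPLFunctionInt p ι 𝔭 κ γ f ΩK' Ωp' Q') :
    constantCoeff Q' = constantCoeff Q := by
  obtain ⟨m, x₀, φ, φ', r, r', hm, -, hx, hunr, hinf, hr, hrκ, hval, hunr', hinf', hr', hrκ', hval'⟩ :=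
    exists_interpolationSupply_pow hp2 ι K κ hK hκ γ hγ
  exact constantCoeff_eq_of_isBDPLFunctionInt_of_supply K N ι 𝔭 κ γ f ΩK ΩK' Ωp Ωp' Q Q' m x₀ φ φ'
    r r' hm hx hunr hinf hr hrκ hval hunr' hinf' hr' hrκ' hval' hΩK hΩK' hΩp hΩp' hQ hQ'

end BDP

end Summit.BirchSwinnertonDyer.Rank1Residual.X11b

end
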